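import Summits.BirchSwinnertonDyer.BirchSwinnertonDyer.Theorems.ManinLocalTwoThreeShimuraKernelHeckeU
import Summits.BirchSwinnertonDyer.BirchSwinnertonDyer.Theorems.ManinLocalTwoThreeManinOfStevensReducedLevels
import HarnessLib

/-!
# The Hecke congruences of the Shimura quotient AT THE PRIME 2 (unconditional): at `4 ∣ N` an ODD SQUARE factor of `N` forces `Λ₁(f) = Λ₀(f)` (so `|c₀| = |c₁|`), and `Λ₁ ≠ Λ₀` forces `a_p(W)` EVEN for every odd `p ∤ N`
(route `ManinLocalTwoThree`, crux C2 `ManinOddAtFour` stmt-BirchSwinnertonDyer-22967 (Γ₀/Γ₁ transfer E-an-151, Shimura index E-an-152b) and C3; cell bsd-f2-manin,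
C2/C3 LEAD p1 gen 17; `--supports stmt-BirchSwinnertonDyer-22967`; the `p = 2` twin of the lead's `U_q` / `T_p` congruences p742991 / p742588)

* **`periodLatticeGamma1_eq_of_four_dvd_of_odd_sq_dvd`** — `4 ∣ N`, `q` odd prime, `q² ∣ N` ⟹ `Λ₁(f) = Λ₀(f)` (`a_q = 0` so `q·Λ₀ ⊆ Λ₁` by the `U_q` congruence, and
  `2Λ₀ ⊆ Λ₁` by the traceless prime `2`; Bézout): Stevens' curve IS the optimal curve at every level `4q²M`, e.g. `N = 36, 100, 144, 196, 252, 324, 400, 468, 484, …`;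
  **`natAbs_maninConstant₀_eq_of_four_dvd_of_odd_sq_dvd`** — hence `|c₀| = |c₁|` UNCONDITIONALLY there (E-an-151's transfer, tree theorem
  `natAbs_maninConstant₀_eq_of_periodLatticeGamma1_eq_periodLattice`).
* **`even_lFunction_of_four_dvd_of_ne`** — `4 ∣ N`, `Λ₁(f) ≠ Λ₀(f)` ⟹ `2 ∣ a_p(W)` for every odd prime `p ∤ N` (Eisenstein mod 2: the Shimura `2`-kernel of C2's
  Σ(2N)[2] branch lives only on curves with all good odd `a_p` even).

HONEST FRAMING.  Unconditional; C2, C3, Manin's conjecture and BSD are NOT proved.  No definitions, no named facts, no sorry.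
[cite: CremonaAlgorithms1997, §2.4 (2.4.1)] [cite: LingOesterle1991, Thm. 1 and Thm. 6 (shape)] [cite: Stevens1989, §2]
-/

set_option autoImplicit false
-- lint-debt: the directory name repeats the summit name (sibling precedent `ManinLocalTwoThreeShimuraKernelHeckeU.lean`)
set_option linter.dupNamespace false

noncomputable section

open scoped Classical MatrixGroups ModularForm PeriodPair
open CongruenceSubgroup Complex
open WeierstrassCurve Literature.NumberTheory.EllipticCurves Literature.NumberTheory.EllipticCurves.ModularForms

namespace Summit.BirchSwinnertonDyer.BirchSwinnertonDyer.Theorems.ManinLocalTwoThree.SigmaHabitat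

variable {W W₁ : WeierstrassCurve ℚ} {N : ℕ} [NeZero N]

/-- **`4 ∣ N`, `q` odd prime, `q² ∣ N` ⟹ `Λ₁(f) = Λ₀(f)`** (UNCONDITIONAL). [cite: LingOesterle1991, Thm. 6 (shape)] -/
theorem periodLatticeGamma1_eq_of_four_dvd_of_odd_sq_dvd (D : ModularParametrizationData W N) (h4 : 2 ^ 2 ∣ N)
    {q : ℕ} (hq : q.Prime) (hq2 : q ≠ 2) (hsq : q ^ 2 ∣ N) : periodLatticeGamma1 D.f = periodLattice D.f := by
  haveI : Fact q.Prime := ⟨hq⟩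
  have hqN : q ∣ N := (dvd_pow_self q two_ne_zero).trans hsq
  have h0 : (W.LFunction q : ℤ) = 0 := by
    have h := D.isNewformOf.2 q
    rw [D.isNewformOf.1.cuspCoeff_eq_zero_of_sq_dvd hq hsq] at h
    exact_mod_cast h.symm
  have hodd : Nat.Coprime 2 q := (Nat.coprime_primes Nat.prime_two hq).mpr (Ne.symm hq2)
  obtain ⟨α, β, hαβ⟩ := Nat.isCoprime_iff_coprime.mpr hodd
  have hαβ' : α * 2 + β * (q : ℤ) = 1 := by simpa using hαβ
  refine le_antisymm (periodLatticeGamma1_le_periodLattice D.f) fun z hz ↦ ?_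
  have hA := two_mul_mem_periodLatticeGamma1_of_four_dvd D h4 hz
  have hB := sub_mul_mem_periodLatticeGamma1_of_heckeU D.f hqN (heckeT_eq_lFunction_smul D) hz
  rw [h0] at hB
  have h1 : (α : ℂ) * 2 + (β : ℂ) * (q : ℂ) = 1 := by exact_mod_cast hαβ'
  push_cast at hB
  have key : z = (α : ℂ) * (2 * z) + (-(β : ℂ)) * ((0 - (q : ℂ)) * z) := by
    linear_combination -z * h1
  rw [key]
  have ha := (periodLatticeGamma1 D.f).zsmul_mem hA α
  have hb := (periodLatticeGamma1 D.f).zsmul_mem hB (-β)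
  rw [zsmul_eq_mul] at ha hb
  push_cast at hb
  exact add_mem ha hb

/-- **`|c₀| = |c₁|` UNCONDITIONALLY at every level `4 ∣ N` with an odd square factor** (optimal `X₁(N)`-datum `D₁`, lattice-optimal `X₀(N)`-datum `D₀` of
isogenous globally minimal curves). [cite: Stevens1989, §2] -/
theorem natAbs_maninConstant₀_eq_of_four_dvd_of_odd_sq_dvd [W₁.IsElliptic] [W₁.IsGloballyMinimal] [W.IsElliptic] [W.IsGloballyMinimal]
    (h4 : 2 ^ 2 ∣ N) {q : ℕ} (hq : q.Prime) (hq2 : q ≠ 2) (hsq : q ^ 2 ∣ N)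
    (D₁ : Gamma1ParametrizationData W₁ N) (D₀ : ModularParametrizationData W N) (hiso : IsIsogenous W₁ W)
    (h₁ : D₁.IsOptimal) (h₀ : ∀ z ∈ D₀.L.lattice, ∃ w ∈ periodLattice D₀.f, z = D₀.c * w) :
    D₀.maninConstant.natAbs = D₁.maninConstant.natAbs :=
  natAbs_maninConstant₀_eq_of_periodLatticeGamma1_eq_periodLattice D₁ D₀ h₁ h₀ (D₁.f_eq_of_isIsogenous D₀ hiso)
    (periodLatticeGamma1_eq_of_four_dvd_of_odd_sq_dvd D₀ h4 hq hq2 hsq)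

/-- **`4 ∣ N`, `Λ₁(f) ≠ Λ₀(f)` ⟹ `a_p(W)` is EVEN for every odd prime `p ∤ N`** (UNCONDITIONAL; the Eisenstein congruence mod 2). [cite: LingOesterle1991, Thm. 1 (shape)] -/
theorem even_lFunction_of_four_dvd_of_ne (D : ModularParametrizationData W N) (h4 : 2 ^ 2 ∣ N)
    (hne : periodLatticeGamma1 D.f ≠ periodLattice D.f) {p : ℕ} [Fact p.Prime] (hp2 : p ≠ 2) (hpN : ¬ p ∣ N) :
    (2 : ℤ) ∣ W.LFunction p := by
  have hp : p.Prime := Fact.out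
  have hpodd : ¬ (2 : ℤ) ∣ (p : ℤ) := by
    intro h
    have h' : 2 ∣ p := by exact_mod_cast h
    exact hp2 ((Nat.dvd_prime hp).mp h' |>.resolve_left (by norm_num)).symm
  by_contra hodd
  apply hne
  have hcop : IsCoprime (2 : ℤ) (W.LFunction p - p - 1) := by
    refine Int.isCoprime_iff_gcd_eq_one.mpr ?_
    have h1 := Int.gcd_dvd_left 2 (W.LFunction p - p - 1)
    have h2 := Int.gcd_dvd_right 2 (W.LFunction p - p - 1)
    rcases (Nat.dvd_prime Nat.prime_two).mp (by exact_mod_cast h1) with h | h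
    · exact h
    · exfalso
      rw [h] at h2
      have h2' : (2 : ℤ) ∣ W.LFunction p - p - 1 := by exact_mod_cast h2
      omega
  obtain ⟨α, β, hαβ⟩ := hcop
  refine le_antisymm (periodLatticeGamma1_le_periodLattice D.f) fun z hz ↦ ?_
  have hA := two_mul_mem_periodLatticeGamma1_of_four_dvd D h4 hz
  have hB := sub_mul_mem_periodLatticeGamma1_of_heckeT D.f hpN (heckeT_eq_lFunction_smul D) hz
  have h1 : ((α * 2 + β * (W.LFunction p - p - 1) : ℤ) : ℂ) = 1 := by rw [hαβ]; simp
  push_cast at h1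
  have key : z = (α : ℂ) * (2 * z) + (β : ℂ) * ((((W.LFunction p : ℤ) : ℂ) - p - 1) * z) := by
    linear_combination -z * h1
  rw [key]
  have ha := (periodLatticeGamma1 D.f).zsmul_mem hA α
  have hb := (periodLatticeGamma1 D.f).zsmul_mem hB β
  rw [zsmul_eq_mul] at ha hb
  exact add_mem ha hb

end Summit.BirchSwinnertonDyer.BirchSwinnertonDyer.Theorems.ManinLocalTwoThree.SigmaHabitat

end
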